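import Summits.ResolutionOfSingularities.ResolutionOfSingularities.Theorems.EquisingularLiftEquisingularLiftNatNDProjFrame
import Summits.ResolutionOfSingularities.ResolutionOfSingularities.Theorems.EquisingularLiftEquisingularLiftNatNDLocalNDSquarefree
import Summits.ResolutionOfSingularities.ResolutionOfSingularities.Theorems.EquisingularLiftEquisingularLiftNatNDAffineDictionary
import Literature.AlgebraicGeometry.Resolution.PrimeDivisorIdeals
import HarnessLib

/-!
# Crux EL♮(3) `EquisingularLiftNatThree` (stmt-ResolutionOfSingularities-20148), chain W4.5b — DEAL «ND-K5» brick (B4γ) `ndInv_init`,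
# part 4: THE LOCAL EQUATION IS RADICAL IN `𝒪_{ℙⁿ,x}` AT A LOCALLY NEWTON-NONDEGENERATE POINT

[OURS · L1 W4.5b · EL♮(3) stmt-ResolutionOfSingularities-20148 · (B4γ): the bridge from sub-brick (γ5) (res-L1-w45b-nose-w1,
`ND.sq_dvd_false_of_localND`) to the stalk clause of `ND.IsNDFrameAt` · res-type-027 g20, second hand of the (B4γ) owner res-L1-w45b-nose-w1 ·
helper, `--supports`; def-free; nothing of the manuscript under review [Hironaka2017] is asserted; AI-written, weaker than expert review]

* §1 (commutative algebra) `squarefree_algebraMap_of_forall_prime_sq_not_dvd` — `R` a UFD, `S = R_P`: if no prime `p ∈ P` has `p² ∣ f ≠ 0`, then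
  the image of `f` in `S` is squarefree; `isRadical_span_singleton_of_squarefree` — in a decomposition monoid a squarefree element generates a
  radical ideal (Mathlib `Squarefree.isRadical`, `isRadical_iff_span_singleton`).
* §2 (the ND input) `sq_not_dvd_of_localND` — if `g := θ (f(t + b))` is `LocalND` (`n ≥ 2`, `θ` origin-fixing, `k` algebraically closed), no prime
  `p` with `p(b) = 0` has `p² ∣ f` (push `p` to `θ (p(t + b))`, which has zero constant term and whose square divides `g`, and apply (γ5)); `ne_zero_of_localND`.
* §3 `isRadical_span_stalk_of_localND` — at `x = chartι k n i y₀`, `𝔭_{y₀} = 𝔪_b`, with `χ : k[t] → 𝒪_{ℙⁿ,x}` the chart ring map (a localisation at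
  `𝔪_b`): `(χ f)·𝒪_{ℙⁿ,x}` is a radical ideal (`𝒪_{ℙⁿ,x}` is factorial: regular, Auslander–Buchsbaum, tree `Scheme.IsRegular.uniqueFactorizationMonoid_stalk`).
  This is the hypothesis of the (B4γ) owner's `ND.stalkIdeal_vanishingIdeal_closure_range_eq_span`.

References: H. Matsumura, *Commutative Ring Theory* (1986), Thm. 20.3 (regular local rings are factorial) [Matsumura1987]; A. G. Kouchnirenko,
*Polyèdres de Newton et nombres de Milnor*, Invent. Math. 32 (1976) §1 (through (γ5); no bib key, context only).
-/

set_option linter.dupNamespace false -- mandated namespace `Summit.<Summit>.<Problem>` of this single-conjunct summit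

noncomputable section

open CategoryTheory AlgebraicGeometry TopologicalSpace IsLocalRing MvPolynomial
open Literature.AlgebraicGeometry.Resolution
open Literature.AlgebraicGeometry.Motives

namespace Summit.ResolutionOfSingularities.ResolutionOfSingularities.Cruxes.EquisingularLiftNat.Sections.ND

/-! ## §1 Squarefree images in a localisation of a factorial domain -/

section Algebra

/-- **No square prime factor inside `P` ⇒ squarefree in `R_P`.** `R` a factorial domain, `S` its localisation at the prime `P`, `f ≠ 0`:
if `p² ∤ f` for every prime `p ∈ P`, then the image of `f` in `S` is squarefree. [cite: Matsumura1987, Thm. 20.3 (context); folklore] -/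
theorem squarefree_algebraMap_of_forall_prime_sq_not_dvd {R S : Type*} [CommRing R] [IsDomain R] [UniqueFactorizationMonoid R]
    [CommRing S] [Algebra R S] (P : Ideal R) [P.IsPrime] [IsLocalization.AtPrime S P]
    {f : R} (hf : f ≠ 0) (h : ∀ p : R, Prime p → p ∈ P → ¬ p ^ 2 ∣ f) :
    Squarefree (algebraMap R S f) := by
  classical
  intro z hz
  by_contra hzu
  obtain ⟨w, hw⟩ := hz
  obtain ⟨a, s, rfl⟩ := IsLocalization.exists_mk'_eq P.primeCompl z
  obtain ⟨c, t, rfl⟩ := IsLocalization.exists_mk'_eq P.primeCompl w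
  -- `z` is not a unit: `a ∈ P`
  have haP : a ∈ P := by
    by_contra haP
    exact hzu ((IsLocalization.AtPrime.isUnit_mk'_iff S P a s).mpr haP)
  -- the relation in `R`: `u · (s s t) · f = u · (a a c)`
  have hw' : IsLocalization.mk' S f (1 : P.primeCompl) = IsLocalization.mk' S (a * a * c) (s * s * t) := by
    rw [IsLocalization.mk'_one, hw, IsLocalization.mk'_mul, IsLocalization.mk'_mul]
  rw [IsLocalization.mk'_eq_iff_eq, Submonoid.coe_one, one_mul] at hw'
  obtain ⟨u, hu⟩ := (IsLocalization.eq_iff_exists P.primeCompl S).mp hw'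
  -- `hu : ↑u * (↑(s * s * t) * f) = ↑u * (a * a * c)`
  have hm : (u : R) * ((s * s * t : P.primeCompl) : R) ∈ P.primeCompl := P.primeCompl.mul_mem u.2 (s * s * t).2
  -- `a ≠ 0`
  have ha0 : a ≠ 0 := by
    rintro rfl
    have h0 : (u : R) * ((s * s * t : P.primeCompl) : R) * f = 0 := by rw [mul_assoc, hu]; ring
    rcases mul_eq_zero.mp h0 with h1 | h1
    · exact hm (by rw [h1]; exact P.zero_mem)
    · exact hf h1
  -- a prime factor `p ∈ P` of `a` has `p² ∣ (u s s t) · f` with `p ∤ u s s t`, hence `p² ∣ f`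
  obtain ⟨p, hp, hpa, hpP⟩ := exists_prime_dvd_mem_of_mem (inferInstance : P.IsPrime) ha0 haP
  have hndvd : ¬ p ∣ (u : R) * ((s * s * t : P.primeCompl) : R) := by
    rintro ⟨r, hr⟩
    exact hm (by rw [hr]; exact P.mul_mem_right r hpP)
  have h2 : p ^ 2 ∣ ((u : R) * ((s * s * t : P.primeCompl) : R)) * f := by
    rw [mul_assoc, hu, sq]
    exact ((mul_dvd_mul hpa hpa).mul_right c).mul_left (u : R)
  exact h p hp hpP (hp.pow_dvd_of_dvd_mul_left 2 hndvd h2)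

/-- A squarefree element of a decomposition monoid generates a radical ideal. [folklore] -/
theorem isRadical_span_singleton_of_squarefree {S : Type*} [CommRing S] [IsDomain S] [DecompositionMonoid S] {x : S}
    (hx : Squarefree x) : (Ideal.span {x}).IsRadical :=
  (isRadical_iff_span_singleton).mp hx.isRadical

end Algebra

/-! ## §2 The ND input: no square factor through `b` -/

section NDInput

variable {k : Type} [Field k] {n : ℕ}

/-- A convenient germ in `n ≥ 1` variables is non-zero. [folklore] -/
theorem ne_zero_of_isConvenient (hn : 1 ≤ n) {g : MvPolynomial (Fin n) k} (hg : IsConvenient g) : g ≠ 0 := by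
  rintro rfl
  obtain ⟨m, -, hm⟩ := hg.2 ⟨0, hn⟩
  exact hm (coeff_zero _)

/-- `f ≠ 0` when `θ (f(t + b))` is `LocalND` (`n ≥ 1`). [folklore] -/
theorem ne_zero_of_localND_localCoords (hn : 1 ≤ n) (θ : MvPolynomial (Fin n) k ≃ₐ[k] MvPolynomial (Fin n) k) (b : Fin n → k)
    {f : MvPolynomial (Fin n) k} (hg : LocalND (θ (translate b f))) : f ≠ 0 := by
  rintro rfl
  have h0 : θ (translate b (0 : MvPolynomial (Fin n) k)) = 0 := by
    rw [show translate b (0 : MvPolynomial (Fin n) k) = 0 from map_zero _, map_zero]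
  exact ne_zero_of_isConvenient hn hg.1 h0

/-- **No square factor through `b`.** If `g := θ (f(t + b))` is `LocalND` (`n ≥ 2`, `θ` origin-fixing, `k` algebraically closed), then no prime
`p ∈ k[t]` with `p(b) = 0` has `p² ∣ f` — its push-forward `θ (p(t + b))` would be a square factor of `g` through the origin, excluded by
(γ5) `ND.sq_dvd_false_of_localND` (Kouchnirenko 1976, §1). [folklore] -/
theorem sq_not_dvd_of_localND (hn : 2 ≤ n) [IsAlgClosed k] (θ : MvPolynomial (Fin n) k ≃ₐ[k] MvPolynomial (Fin n) k) (hθ : FixesOrigin θ)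
    (b : Fin n → k) {f : MvPolynomial (Fin n) k} (hg : LocalND (θ (translate b f)))
    (p : MvPolynomial (Fin n) k) (hpb : p ∈ MvPolynomial.vanishingIdeal k {b}) : ¬ p ^ 2 ∣ f := by
  intro hdvd
  have hP0 : constantCoeff (θ (translate b p)) = 0 := by
    rw [constantCoeff_apply_of_fixesOrigin θ hθ, constantCoeff_translate]
    exact (MvPolynomial.mem_vanishingIdeal_singleton_iff b p).mp hpb
  have hdvd' : θ (translate b p) ^ 2 ∣ θ (translate b f) := by
    have h1 : translate b p ^ 2 ∣ translate b f := by
      change (aeval fun j => X j + C (b j)) p ^ 2 ∣ (aeval fun j => X j + C (b j)) f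
      rw [← map_pow]; exact map_dvd _ hdvd
    rw [← map_pow]; exact map_dvd _ h1
  exact sq_dvd_false_of_localND hn hg hP0 hdvd'

/-- The same, phrased with primes of `𝔭_{y₀} = 𝔪_b` as in §1. [folklore] -/
theorem forall_prime_sq_not_dvd_of_localND (hn : 2 ≤ n) [IsAlgClosed k] (θ : MvPolynomial (Fin n) k ≃ₐ[k] MvPolynomial (Fin n) k)
    (hθ : FixesOrigin θ) (b : Fin n → k) {f : MvPolynomial (Fin n) k} (hg : LocalND (θ (translate b f)))
    {P : Ideal (MvPolynomial (Fin n) k)} (hP : P = MvPolynomial.vanishingIdeal k {b}) :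
    ∀ p : MvPolynomial (Fin n) k, Prime p → p ∈ P → ¬ p ^ 2 ∣ f := by
  intro p _ hpP
  exact sq_not_dvd_of_localND hn θ hθ b hg p (hP ▸ hpP)

end NDInput

/-! ## §3 The local equation generates a radical ideal of `𝒪_{ℙⁿ,x}` -/

section Stalk

variable (k : Type) [Field k] (n : ℕ)

/-- **`(χ f)·𝒪_{ℙⁿ,x}` IS RADICAL at a locally Newton-nondegenerate point.** At `x = chartι k n i y₀`, `𝔭_{y₀} = 𝔪_b`, with `χ : k[t] → 𝒪_{ℙⁿ,x}`
a localisation at `𝔭_{y₀}` and `θ` origin-fixing: if `θ (f(t + b))` is `LocalND` (`n ≥ 2`, `k = k̄`), the ideal `(χ f)` of the factorial local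
ring `𝒪_{ℙⁿ,x}` is radical. [cite: Matsumura1987, Thm. 20.3] -/
theorem isRadical_span_stalk_of_localND [IsAlgClosed k] (hn : 2 ≤ n) (i : Fin (n + 1)) (b : Fin n → k)
    (y₀ : Spec (CommRingCat.of (MvPolynomial (Fin n) k))) (hy₀ : y₀.asIdeal = MvPolynomial.vanishingIdeal k {b})
    (χ : MvPolynomial (Fin n) k →+* (projectiveSpace n k).left.presheaf.stalk (ProjectiveSpaceCells.chartι k n i y₀))
    (hχ : letI := χ.toAlgebra
      IsLocalization.AtPrime ((projectiveSpace n k).left.presheaf.stalk (ProjectiveSpaceCells.chartι k n i y₀)) y₀.asIdeal)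
    (θ : MvPolynomial (Fin n) k ≃ₐ[k] MvPolynomial (Fin n) k) (hθ : FixesOrigin θ)
    (f : MvPolynomial (Fin n) k) (hg : LocalND (θ (translate b f))) :
    (Ideal.span {χ f}).IsRadical := by
  classical
  letI := χ.toAlgebra
  haveI := hχ
  haveI : IsIntegral (projectiveSpace n k).left := isIntegral_projectiveSpace n k
  haveI := (isSmoothProjective_projectiveSpace_holds k n).smoothOfRelativeDimension
  haveI : Smooth (projectiveSpace n k).hom := SmoothOfRelativeDimension.smooth n (projectiveSpace n k).hom
  haveI : IsLocallyNoetherian (projectiveSpace n k).left := LocallyOfFiniteType.isLocallyNoetherian (projectiveSpace n k).hom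
  haveI : UniqueFactorizationMonoid ((projectiveSpace n k).left.presheaf.stalk (ProjectiveSpaceCells.chartι k n i y₀)) :=
    (isRegular_projectiveSpace n k).uniqueFactorizationMonoid_stalk _
  have hn1 : 1 ≤ n := le_trans (by norm_num) hn
  have hsq : Squarefree (algebraMap (MvPolynomial (Fin n) k)
      ((projectiveSpace n k).left.presheaf.stalk (ProjectiveSpaceCells.chartι k n i y₀)) f) :=
    squarefree_algebraMap_of_forall_prime_sq_not_dvd y₀.asIdeal (ne_zero_of_localND_localCoords hn1 θ b hg)
      (forall_prime_sq_not_dvd_of_localND hn θ hθ b hg hy₀)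
  exact isRadical_span_singleton_of_squarefree hsq

end Stalk

end Summit.ResolutionOfSingularities.ResolutionOfSingularities.Cruxes.EquisingularLiftNat.Sections.ND

end
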